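import Summits.CriticalPhenomena.PercolationContinuityZ3.Theorems.PercNearOneGluingNoHeavyLowerTailSahiGridPatternTwoCylinders

/-!
# `NoHeavyLowerTail` (crux stmt-CriticalPhenomena-4575), Sahi programme P1: **THE ROUNDING REDUCTION** —
# `PatternPos d` follows from a local rounding alternative plus positivity on the RESOLVED (two-valued, twisted Boolean) triples

Support file (seat `prim-sahi-p1`, generation 12; `--supports stmt-CriticalPhenomena-4575`).  Pure proofs; the only definitions are
the bookkeeping ones of the rounding calculus (`axSwap`, `AxInv`, `lo`, `hi`, `roundUp`, `roundDown`, `rnd`, `Resolved`) and the two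
finite `Prop`s `RoundingAlternative d`, `ResolvedPos d` (obligations / hypotheses, never facts); no `sorry`, standard axioms.

THE MATHEMATICS (this is Lieb–Sahi's two-dimensional "perturbation" argument [Lieb–Sahi 2022, §2.1, Props 2.6–2.9] transplanted to the
three-level Latin cube `[3]^d` of the pattern functional `sStarD`, every `d`).  Fix an axis `a` and an adjacent level pair
`(lo, hi) = (j, j+1)`, `j ∈ {0,1}`.  For an up-set `X ⊆ [3]^d` with sections `X_lo ⊆ X_hi` on axis `a`, the two ROUNDINGS are
  `roundUp a j X = X ∪ {x : x_a = lo, x[a ↦ hi] ∈ X}`   (section at `lo` raised to the section at `hi`),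
  `roundDown a j X = X ∖ {x : x_a = hi, x[a ↦ lo] ∉ X}` (section at `hi` lowered to the section at `lo`).
Both are up-sets (`isUpperSet_roundUp/Down`), both are invariant under the value transposition `(lo hi)` on axis `a`
(`axInv_roundUp/Down`), and both keep every invariance under value transpositions on the OTHER axes (`axInv_roundUp/Down_of_ne`).
Call axis `a` RESOLVED for a triple `(A,B,C)` when all three sets are invariant under `(0 1)` on `a`, or all three under `(1 2)` on `a`
(`Resolved`); a triple resolved on every axis is a TWISTED BOOLEAN SHADOW (each set reads, per axis, only `[x_a = 2]` or only `[x_a ≠ 0]`),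
on which `sStarD = 2^d · threePartNT` (`…ShadowTPPTwisted.sStarD_twistedShadow_eq`, generation 10).  Rounding all three sets at `(a, j)`
(with independent signs) resolves axis `a` and keeps resolved axes resolved; so, by induction on the number of unresolved axes:
**THEOREM (`patternPos_of_roundingAlternative`).**  `RoundingAlternative d → ResolvedPos d → PatternPos d`, where
* `RoundingAlternative d`: every up-set triple with an unresolved axis admits, on SOME unresolved axis `a`, a level pair `j` and signs
  `(s_A, s_B, s_C)` such that `sStarD (rnd s_A a j A) (rnd s_B a j B) (rnd s_C a j C) ≤ sStarD A B C` (one of the `16` roundings does not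
  increase the functional);
* `ResolvedPos d`: `sStarD A B C ≥ 0` for every up-set triple resolved on every axis (= twisted three-partition positivity on `d`
  letters; a finite Boolean statement, exhaustively checkable for `d ≤ 5`).
Part 2 (`…SahiGridPatternRoundingLinear`, `sStarD_roundUp_add_roundDown`, unconditional, every `d`): if `B` and `C` are
`(lo hi)`-invariant on axis `a` then `sStarD (roundUp a j A) B C + sStarD (roundDown a j A) B C = 2 · sStarD A B C` — a descent owned by
ONE set is linear (Lieb–Sahi's Prop. 2.6 in `[3]^d`), so such descents never obstruct.
STATUS / HONEST LABELS.  `RoundingAlternative d` is an OPEN finite combinatorial statement (seat evidence on item 4575: exhaustive for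
`d ≤ 3`, no counterexample in adversarial search at `d = 4, 5`; the stronger per-`(a,j)` form "min of the 8 roundings ≤ sStarD at EVERY
descent" is FALSE at `d = 4`, as are the uniform-sign and single-level-pair variants — explicit witnesses in the seat memo).
`ResolvedPos 5` is a finite computation (seat kit job; census §31 W41h for the untwisted part).  Nothing here asserts `PatternPos d`
for `d ≥ 4`, Kahn's Conjecture 5 or Sahi's `C₃`. [this work]
-/

namespace Summit.CriticalPhenomena.PercolationContinuityZ3.Theorems.SahiGridPattern

open Finset
open scoped Classical

variable {d : ℕ}

/-! ### Value transpositions on one axis -/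

/-- The value transposition `(u v)` applied to coordinate `a` of a point of `[3]^d`. [this work] -/
def axSwap (a : Fin d) (u v : Fin 3) (x : Pd d) : Pd d := Function.update x a (Equiv.swap u v (x a))

/-- A set is invariant under the value transposition `(u v)` on axis `a`. [this work] -/
def AxInv (a : Fin d) (u v : Fin 3) (X : Finset (Pd d)) : Prop := ∀ x : Pd d, x ∈ X ↔ axSwap a u v x ∈ X

/-- Lower level of the adjacent pair `j ↦ (j, j+1)`. [this work] -/
def lo (j : Fin 2) : Fin 3 := Fin.castSucc j

/-- Upper level of the adjacent pair `j ↦ (j, j+1)`. [this work] -/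
def hi (j : Fin 2) : Fin 3 := Fin.succ j

/-- `lo j < hi j`. [this work] -/
theorem lo_lt_hi (j : Fin 2) : lo j < hi j := by
  unfold lo hi; exact Fin.castSucc_lt_succ

/-- `lo j ≠ hi j`. [this work] -/
theorem lo_ne_hi (j : Fin 2) : lo j ≠ hi j := (lo_lt_hi j).ne

/-- In `Fin 3`, above `lo j` means at least `hi j`. [this work] -/
theorem hi_le_of_lo_lt {j : Fin 2} {v : Fin 3} (h : lo j < v) : hi j ≤ v := by
  unfold lo hi at *; rw [Fin.lt_def] at h; rw [Fin.le_def]; simp at h ⊢; omega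

/-- In `Fin 3`, below `hi j` means at most `lo j`. [this work] -/
theorem le_lo_of_lt_hi {j : Fin 2} {v : Fin 3} (h : v < hi j) : v ≤ lo j := by
  unfold lo hi at *; rw [Fin.lt_def] at h; rw [Fin.le_def]; simp at h ⊢; omega

/-- The swapped coordinate. [this work] -/
theorem axSwap_apply_self (a : Fin d) (u v : Fin 3) (x : Pd d) : axSwap a u v x a = Equiv.swap u v (x a) := by
  unfold axSwap; simp

/-- The other coordinates are untouched. [this work] -/
theorem axSwap_apply_ne {a b : Fin d} (hba : b ≠ a) (u v : Fin 3) (x : Pd d) : axSwap a u v x b = x b := by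
  unfold axSwap; rw [Function.update_of_ne hba]

/-- On a point whose `a`-coordinate is `u`, the transposition `(u v)` is the update to `v`. [this work] -/
theorem axSwap_eq_update_of_eq_left {a : Fin d} {u v : Fin 3} {x : Pd d} (h : x a = u) :
    axSwap a u v x = Function.update x a v := by
  unfold axSwap; rw [h, Equiv.swap_apply_left]

/-- On a point whose `a`-coordinate is `v`, the transposition `(u v)` is the update to `u`. [this work] -/
theorem axSwap_eq_update_of_eq_right {a : Fin d} {u v : Fin 3} {x : Pd d} (h : x a = v) :
    axSwap a u v x = Function.update x a u := by
  unfold axSwap; rw [h, Equiv.swap_apply_right]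

/-- Off the two swapped values the transposition fixes the point. [this work] -/
theorem axSwap_eq_self {a : Fin d} {u v : Fin 3} {x : Pd d} (hu : x a ≠ u) (hv : x a ≠ v) : axSwap a u v x = x := by
  unfold axSwap; rw [Equiv.swap_apply_of_ne_of_ne hu hv, Function.update_eq_self]

/-- The transposition is an involution. [this work] -/
theorem axSwap_axSwap (a : Fin d) (u v : Fin 3) (x : Pd d) : axSwap a u v (axSwap a u v x) = x := by
  funext b
  by_cases hb : b = a
  · subst hb; rw [axSwap_apply_self, axSwap_apply_self, Equiv.swap_apply_self]
  · rw [axSwap_apply_ne hb, axSwap_apply_ne hb]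

/-- Transpositions on different axes commute with updates. [this work] -/
theorem axSwap_update_of_ne {a b : Fin d} (hba : b ≠ a) (u v w : Fin 3) (x : Pd d) :
    axSwap b u v (Function.update x a w) = Function.update (axSwap b u v x) a w := by
  unfold axSwap
  rw [Function.update_of_ne hba, Function.update_comm hba]

/-! ### Elementary order facts on `[3]^d` -/

/-- Raising the `a`-coordinate from `lo j` to `hi j` goes up. [this work] -/
theorem le_update_hi_of_eq_lo {a : Fin d} {j : Fin 2} {x : Pd d} (h : x a = lo j) : x ≤ Function.update x a (hi j) := by
  intro b
  by_cases hb : b = a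
  · subst hb; rw [Function.update_self, h]; exact (lo_lt_hi j).le
  · rw [Function.update_of_ne hb]

/-- Lowering the `a`-coordinate from `hi j` to `lo j` goes down. [this work] -/
theorem update_lo_le_of_eq_hi {a : Fin d} {j : Fin 2} {x : Pd d} (h : x a = hi j) : Function.update x a (lo j) ≤ x := by
  intro b
  by_cases hb : b = a
  · subst hb; rw [Function.update_self, h]; exact (lo_lt_hi j).le
  · rw [Function.update_of_ne hb]

/-- Updating one coordinate to a common value is monotone. [this work] -/
theorem update_mono {a : Fin d} {x y : Pd d} (hxy : x ≤ y) (w : Fin 3) : Function.update x a w ≤ Function.update y a w := by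
  intro b
  by_cases hb : b = a
  · subst hb; rw [Function.update_self, Function.update_self]
  · rw [Function.update_of_ne hb, Function.update_of_ne hb]; exact hxy b

/-! ### The roundings -/

/-- `roundUp a j X`: raise the section of `X` at level `lo j` on axis `a` to its section at level `hi j`. [this work] -/
def roundUp (a : Fin d) (j : Fin 2) (X : Finset (Pd d)) : Finset (Pd d) :=
  univ.filter fun x => x ∈ X ∨ (x a = lo j ∧ Function.update x a (hi j) ∈ X)

/-- `roundDown a j X`: lower the section of `X` at level `hi j` on axis `a` to its section at level `lo j`. [this work] -/
def roundDown (a : Fin d) (j : Fin 2) (X : Finset (Pd d)) : Finset (Pd d) :=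
  univ.filter fun x => x ∈ X ∧ (x a = hi j → Function.update x a (lo j) ∈ X)

/-- The signed rounding: `true ↦ roundUp`, `false ↦ roundDown`. [this work] -/
def rnd (s : Bool) (a : Fin d) (j : Fin 2) (X : Finset (Pd d)) : Finset (Pd d) := if s then roundUp a j X else roundDown a j X

/-- Membership in `roundUp`. [this work] -/
theorem mem_roundUp {a : Fin d} {j : Fin 2} {X : Finset (Pd d)} {x : Pd d} :
    x ∈ roundUp a j X ↔ x ∈ X ∨ (x a = lo j ∧ Function.update x a (hi j) ∈ X) := by
  unfold roundUp; simp only [mem_filter, mem_univ, true_and]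

/-- Membership in `roundDown`. [this work] -/
theorem mem_roundDown {a : Fin d} {j : Fin 2} {X : Finset (Pd d)} {x : Pd d} :
    x ∈ roundDown a j X ↔ x ∈ X ∧ (x a = hi j → Function.update x a (lo j) ∈ X) := by
  unfold roundDown; simp only [mem_filter, mem_univ, true_and]

/-- `X ⊆ roundUp a j X`. [this work] -/
theorem subset_roundUp (a : Fin d) (j : Fin 2) (X : Finset (Pd d)) : X ⊆ roundUp a j X :=
  fun _ hx => mem_roundUp.2 (Or.inl hx)

/-- `roundDown a j X ⊆ X`. [this work] -/
theorem roundDown_subset (a : Fin d) (j : Fin 2) (X : Finset (Pd d)) : roundDown a j X ⊆ X :=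
  fun _ hx => (mem_roundDown.1 hx).1

/-- Rounding up preserves up-sets. [this work] -/
theorem isUpperSet_roundUp (a : Fin d) (j : Fin 2) {X : Finset (Pd d)} (hX : IsUpperSet (X : Set (Pd d))) :
    IsUpperSet (roundUp a j X : Set (Pd d)) := by
  intro x y hxy hx
  rw [Finset.mem_coe, mem_roundUp] at hx ⊢
  rcases hx with hx | ⟨hxa, hx'⟩
  · exact Or.inl (hX hxy hx)
  · by_cases hya : y a = lo j
    · exact Or.inr ⟨hya, hX (update_mono hxy (hi j)) hx'⟩
    · left
      have hlt : lo j < y a := lt_of_le_of_ne (hxa ▸ hxy a) (Ne.symm hya)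
      refine hX (show Function.update x a (hi j) ≤ y from fun b => ?_) hx'
      by_cases hb : b = a
      · subst hb; rw [Function.update_self]; exact hi_le_of_lo_lt hlt
      · rw [Function.update_of_ne hb]; exact hxy b

/-- Rounding down preserves up-sets. [this work] -/
theorem isUpperSet_roundDown (a : Fin d) (j : Fin 2) {X : Finset (Pd d)} (hX : IsUpperSet (X : Set (Pd d))) :
    IsUpperSet (roundDown a j X : Set (Pd d)) := by
  intro x y hxy hx
  rw [Finset.mem_coe, mem_roundDown] at hx ⊢
  refine ⟨hX hxy hx.1, fun hya => ?_⟩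
  by_cases hxa : x a = hi j
  · exact hX (update_mono hxy (lo j)) (hx.2 hxa)
  · have hlt : x a < hi j := lt_of_le_of_ne (hya ▸ hxy a) hxa
    refine hX (show x ≤ Function.update y a (lo j) from fun b => ?_) hx.1
    by_cases hb : b = a
    · subst hb; rw [Function.update_self]; exact le_lo_of_lt_hi hlt
    · rw [Function.update_of_ne hb]; exact hxy b

/-- The signed rounding preserves up-sets. [this work] -/
theorem isUpperSet_rnd (s : Bool) (a : Fin d) (j : Fin 2) {X : Finset (Pd d)} (hX : IsUpperSet (X : Set (Pd d))) :
    IsUpperSet (rnd s a j X : Set (Pd d)) := by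
  unfold rnd; split_ifs
  · exact isUpperSet_roundUp a j hX
  · exact isUpperSet_roundDown a j hX

/-- `roundUp a j X` is invariant under the transposition `(lo hi)` on axis `a` (for an up-set `X`). [this work] -/
theorem axInv_roundUp (a : Fin d) (j : Fin 2) {X : Finset (Pd d)} (hX : IsUpperSet (X : Set (Pd d))) :
    AxInv a (lo j) (hi j) (roundUp a j X) := by
  intro x
  rw [mem_roundUp, mem_roundUp]
  by_cases h1 : x a = lo j
  · have hs : axSwap a (lo j) (hi j) x = Function.update x a (hi j) := axSwap_eq_update_of_eq_left h1
    rw [hs, Function.update_self]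
    constructor
    · rintro (hx | ⟨-, hx⟩)
      · exact Or.inl (hX (le_update_hi_of_eq_lo h1) hx)
      · exact Or.inl hx
    · rintro (hx | ⟨habs, -⟩)
      · exact Or.inr ⟨h1, hx⟩
      · exact absurd habs (lo_ne_hi j).symm
  · by_cases h2 : x a = hi j
    · have hs : axSwap a (lo j) (hi j) x = Function.update x a (lo j) := axSwap_eq_update_of_eq_right h2
      have hupd : Function.update (Function.update x a (lo j)) a (hi j) = x := by
        rw [Function.update_idem, ← h2, Function.update_eq_self]
      have hle : Function.update x a (lo j) ≤ x := update_lo_le_of_eq_hi h2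
      rw [hs]
      constructor
      · rintro (hx | ⟨habs, -⟩)
        · exact Or.inr ⟨Function.update_self a (lo j) x, by rw [hupd]; exact hx⟩
        · exact absurd habs h1
      · rintro (hy | ⟨-, hy⟩)
        · exact Or.inl (hX hle hy)
        · rw [hupd] at hy; exact Or.inl hy
    · rw [axSwap_eq_self h1 h2]

/-- `roundDown a j X` is invariant under the transposition `(lo hi)` on axis `a` (for an up-set `X`). [this work] -/
theorem axInv_roundDown (a : Fin d) (j : Fin 2) {X : Finset (Pd d)} (hX : IsUpperSet (X : Set (Pd d))) :
    AxInv a (lo j) (hi j) (roundDown a j X) := by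
  intro x
  rw [mem_roundDown, mem_roundDown]
  by_cases h1 : x a = lo j
  · have hs : axSwap a (lo j) (hi j) x = Function.update x a (hi j) := axSwap_eq_update_of_eq_left h1
    have hupd : Function.update (Function.update x a (hi j)) a (lo j) = x := by
      rw [Function.update_idem, ← h1, Function.update_eq_self]
    have hle : x ≤ Function.update x a (hi j) := le_update_hi_of_eq_lo h1
    rw [hs]
    constructor
    · rintro ⟨hx, -⟩
      exact ⟨hX hle hx, fun _ => by rw [hupd]; exact hx⟩
    · rintro ⟨-, hy⟩
      have hx : x ∈ X := by
        have := hy (Function.update_self a (hi j) x)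
        rwa [hupd] at this
      exact ⟨hx, fun habs => absurd (h1.symm.trans habs) (lo_ne_hi j)⟩
  · by_cases h2 : x a = hi j
    · have hs : axSwap a (lo j) (hi j) x = Function.update x a (lo j) := axSwap_eq_update_of_eq_right h2
      rw [hs, Function.update_self]
      constructor
      · rintro ⟨-, hx⟩
        exact ⟨hx h2, fun habs => absurd habs (lo_ne_hi j)⟩
      · rintro ⟨hx, -⟩
        exact ⟨hX (update_lo_le_of_eq_hi h2) hx, fun _ => hx⟩
    · rw [axSwap_eq_self h1 h2]

/-- The signed rounding at `(a, j)` is `(lo hi)`-invariant on axis `a`. [this work] -/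
theorem axInv_rnd (s : Bool) (a : Fin d) (j : Fin 2) {X : Finset (Pd d)} (hX : IsUpperSet (X : Set (Pd d))) :
    AxInv a (lo j) (hi j) (rnd s a j X) := by
  unfold rnd; split_ifs
  · exact axInv_roundUp a j hX
  · exact axInv_roundDown a j hX

/-- Rounding on axis `a` preserves invariances on every other axis. [this work] -/
theorem axInv_roundUp_of_ne {a b : Fin d} (hba : b ≠ a) {u v : Fin 3} (j : Fin 2) {X : Finset (Pd d)}
    (h : AxInv b u v X) : AxInv b u v (roundUp a j X) := by
  intro x
  rw [mem_roundUp, mem_roundUp, axSwap_apply_ne hba.symm, ← axSwap_update_of_ne hba, ← h x, ← h (Function.update x a (hi j))]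

/-- Rounding on axis `a` preserves invariances on every other axis. [this work] -/
theorem axInv_roundDown_of_ne {a b : Fin d} (hba : b ≠ a) {u v : Fin 3} (j : Fin 2) {X : Finset (Pd d)}
    (h : AxInv b u v X) : AxInv b u v (roundDown a j X) := by
  intro x
  rw [mem_roundDown, mem_roundDown, axSwap_apply_ne hba.symm, ← axSwap_update_of_ne hba, ← h x,
    ← h (Function.update x a (lo j))]

/-- Rounding on axis `a` preserves invariances on every other axis. [this work] -/
theorem axInv_rnd_of_ne (s : Bool) {a b : Fin d} (hba : b ≠ a) {u v : Fin 3} (j : Fin 2) {X : Finset (Pd d)}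
    (h : AxInv b u v X) : AxInv b u v (rnd s a j X) := by
  unfold rnd; split_ifs
  · exact axInv_roundUp_of_ne hba j h
  · exact axInv_roundDown_of_ne hba j h

/-! ### Resolved axes and the two obligations -/

/-- Axis `a` is RESOLVED for the triple `(A,B,C)`: for one of the two adjacent level pairs, all three sets are invariant under the
corresponding value transposition on axis `a` (they "do not see" the difference between the two levels). [this work] -/
def Resolved (a : Fin d) (A B C : Finset (Pd d)) : Prop :=
  ∃ j : Fin 2, AxInv a (lo j) (hi j) A ∧ AxInv a (lo j) (hi j) B ∧ AxInv a (lo j) (hi j) C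

/-- **`RoundingAlternative d`** (the local obligation): every up-set triple of `[3]^d` with an unresolved axis admits, on some
unresolved axis `a`, a level pair `j` and signs such that the simultaneous rounding does not increase `sStarD`.  An OPEN finite
statement (exhaustively verified by the seat for `d ≤ 3`; no counterexample known); an obligation / hypothesis, never a fact. [this work]
[status: open] -/
@[conjecture] def RoundingAlternative (d : ℕ) : Prop :=
  ∀ A B C : Finset (Pd d), IsUpperSet (A : Set (Pd d)) → IsUpperSet (B : Set (Pd d)) → IsUpperSet (C : Set (Pd d)) →
    (∃ a, ¬ Resolved a A B C) →
      ∃ (a : Fin d) (j : Fin 2) (sA sB sC : Bool), ¬ Resolved a A B C ∧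
        sStarD (rnd sA a j A) (rnd sB a j B) (rnd sC a j C) ≤ sStarD A B C

/-- **`ResolvedPos d`** (the two-valued obligation): the pattern inequality on the triples resolved on EVERY axis — the twisted Boolean
shadows, where `sStarD = 2^d · threePartNT` (generation 10).  A finite Boolean statement; an obligation / hypothesis, never a fact.
[this work] [status: open for d ≥ 6; a finite computation for each d] -/
@[conjecture] def ResolvedPos (d : ℕ) : Prop :=
  ∀ A B C : Finset (Pd d), IsUpperSet (A : Set (Pd d)) → IsUpperSet (B : Set (Pd d)) → IsUpperSet (C : Set (Pd d)) →
    (∀ a, Resolved a A B C) → 0 ≤ sStarD A B C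

/-- `PatternPos d` trivially contains `ResolvedPos d`. [this work] -/
theorem resolvedPos_of_patternPos (h : PatternPos d) : ResolvedPos d :=
  fun A B C hA hB hC _ => h A B C hA hB hC

/-- Rounding all three sets at `(a, j)` resolves axis `a`. [this work] -/
theorem resolved_rnd (a : Fin d) (j : Fin 2) (sA sB sC : Bool) {A B C : Finset (Pd d)} (hA : IsUpperSet (A : Set (Pd d)))
    (hB : IsUpperSet (B : Set (Pd d))) (hC : IsUpperSet (C : Set (Pd d))) :
    Resolved a (rnd sA a j A) (rnd sB a j B) (rnd sC a j C) :=
  ⟨j, axInv_rnd sA a j hA, axInv_rnd sB a j hB, axInv_rnd sC a j hC⟩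

/-- Rounding on axis `a` keeps every other resolved axis resolved. [this work] -/
theorem resolved_rnd_of_ne {a b : Fin d} (hba : b ≠ a) (j : Fin 2) (sA sB sC : Bool) {A B C : Finset (Pd d)}
    (h : Resolved b A B C) : Resolved b (rnd sA a j A) (rnd sB a j B) (rnd sC a j C) := by
  obtain ⟨j', h1, h2, h3⟩ := h
  exact ⟨j', axInv_rnd_of_ne sA hba j h1, axInv_rnd_of_ne sB hba j h2, axInv_rnd_of_ne sC hba j h3⟩

/-! ### The reduction -/

/-- **THE ROUNDING REDUCTION.**  If every up-set triple with an unresolved axis admits a non-increasing rounding on an unresolved axis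
(`RoundingAlternative d`), and the pattern inequality holds on the fully resolved (two-valued) triples (`ResolvedPos d`), then it holds on
all up-set triples of `[3]^d`: `PatternPos d`.  Proof: induction on the number of unresolved axes — a rounding at `(a,j)` resolves `a`
(`resolved_rnd`) and keeps resolved axes resolved (`resolved_rnd_of_ne`). [this work] -/
theorem patternPos_of_roundingAlternative (hRA : RoundingAlternative d) (hRP : ResolvedPos d) : PatternPos d := by
  suffices key : ∀ n : ℕ, ∀ A B C : Finset (Pd d), IsUpperSet (A : Set (Pd d)) → IsUpperSet (B : Set (Pd d)) →
      IsUpperSet (C : Set (Pd d)) → (univ.filter fun a => ¬ Resolved a A B C).card ≤ n → 0 ≤ sStarD A B C by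
    intro A B C hA hB hC
    exact key _ A B C hA hB hC le_rfl
  intro n
  induction n with
  | zero =>
    intro A B C hA hB hC hn
    refine hRP A B C hA hB hC fun a => ?_
    by_contra hna
    have hmem : a ∈ univ.filter fun a => ¬ Resolved a A B C := by simp [hna]
    have : 0 < (univ.filter fun a => ¬ Resolved a A B C).card := card_pos.2 ⟨a, hmem⟩
    omega
  | succ n ih =>
    intro A B C hA hB hC hn
    by_cases hall : ∀ a, Resolved a A B C
    · exact hRP A B C hA hB hC hall
    · obtain ⟨a, j, sA, sB, sC, hna, hle⟩ := hRA A B C hA hB hC (not_forall.1 hall)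
      have hsub : (univ.filter fun b => ¬ Resolved b (rnd sA a j A) (rnd sB a j B) (rnd sC a j C)) ⊆
          (univ.filter fun b => ¬ Resolved b A B C).erase a := by
        intro b hb
        simp only [mem_filter, mem_univ, true_and, mem_erase] at hb ⊢
        refine ⟨?_, ?_⟩
        · rintro rfl; exact hb (resolved_rnd b j sA sB sC hA hB hC)
        · intro hres
          by_cases hba : b = a
          · subst hba; exact hb (resolved_rnd b j sA sB sC hA hB hC)
          · exact hb (resolved_rnd_of_ne hba j sA sB sC hres)
      have hmem : a ∈ univ.filter fun b => ¬ Resolved b A B C := by simp [hna]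
      have hcard : (univ.filter fun b => ¬ Resolved b (rnd sA a j A) (rnd sB a j B) (rnd sC a j C)).card ≤ n := by
        have h1 := card_le_card hsub
        rw [card_erase_of_mem hmem] at h1
        omega
      exact (ih _ _ _ (isUpperSet_rnd sA a j hA) (isUpperSet_rnd sB a j hB) (isUpperSet_rnd sC a j hC) hcard).trans hle

end Summit.CriticalPhenomena.PercolationContinuityZ3.Theorems.SahiGridPattern
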